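import Summits.MatrixMultiplication.OmegaCensus.STPPSmallPatternLawBridge
import Summits.MatrixMultiplication.OmegaCensus.STPPSmallPatternThreeAPFreeSplit

/-!
# ω-census, small STPP pattern `(1,2,2)^k`: the SPLIT LAW BRIDGE — order laws from a core over exponents `≤ 2F` and a thin band `≤ 4F + 1`

HONEST FRAMING (pub-omega census; verbatim): lottery ticket; floor = certified bounds/negative ranges.
Census STRUCTURE tool of the STPP track (seat pub-omega-stpp-3, gen 30); nothing here bears on `ω`.

The all-type laws «`|G| ≥ N ⇒ (1,2,2)^k ⊆ G`» so far split on the exponent `e` of `G`: `e ≥ 8F + 4` ⇒ ENG2's cyclic ray (`F` = the largest element of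
a Salem–Spencer seed of size `k`), `e ≤ 8F + 3` ⇒ the generic seed bridge `STPPSmallPatternLawBridge.lean` over ALL prime powers `≤ 8F + 3` (the kernel
enumerates every capped multiset of every exponent — 2.6 million of them at `k = 21`).  With the split 3-AP-free families
(`STPPSmallPatternThreeAPFreeSplit.lean`) two GENERIC branches need no core at all:

* `exists_isSTPP_122pow_of_addOrderOf_split` — an element `g` of order `≥ 2F + 1` with `|G| ≥ 4·ord g`: the quotient `G ⧸ ⟨g⟩` has order `≥ 4`, hence
  two «sign-independent» elements (`x ≠ 0`, `y ∉ {0, ±x}`: `signIndep_of_ne`), whose lifts `κ₁, κ₂` with `g` satisfy the bounded independence of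
  `exists_isSTPP_122pow_of_apSplit`;
* `exists_isSTPP_122pow_of_addOrderOf_halfSplit` — an element `g` of order `≥ 4F + 2` with `|G| ≥ 2·ord g`: one choice bit by parity on `g`, the other on
  a lift `κ` of a nonzero element of `G ⧸ ⟨g⟩` (family `isSTPP_apHalfSplitFam122`: `{0} / {4fᵢ•g, 4fᵢ•g + κ} / {2fᵢ•g, (2fᵢ+1)•g}`).

Since the exponent divides `|G|`, for `|G| ≥ N ≥ 8F + 4` this leaves: `e ≥ 8F + 4` (ray); `4F + 2 ≤ e < 8F + 4` ⇒ `|G| ≥ 2e` (half-split);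
`2F + 1 ≤ e ≤ 4F + 1` ⇒ `|G| ≥ 3e`, and `|G| ≥ 4e` is the split branch — only `|G| = 3e` needs a seed core, and there every relevant capped multiset has
product `≤ 3e` (`exists_seed_emb_of_core_min_le`, the minimal bridge with a product bound threaded through); `e ≤ 2F` ⇒ the minimal bridge as before.
**`exists_isSTPP_122pow_of_card_ge_split`** packages this: from the ray, a core over the exponents `≤ 2F` and a BAND core over `2F < E ≤ 4F + 1`
restricted to multisets of product `≤ 3E`, every finite abelian group of order `≥ N` hosts `(1,2,2)^k` (at `k = 21`: `0.64` instead of `2.6` million capped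
multisets; the band restriction is a hypothesis of the `decide`, so the kernel still enumerates the band's cap lists — a finer band is successor work).

References: H. Cohn, R. Kleinberg, B. Szegedy, C. Umans, FOCS 2005 (arXiv:math/0511460), Def. 5.1; structure theorem = Mathlib
`AddCommGroup.equiv_directSum_zmod_of_finite`.
-/

open Literature.Computability.AlgebraicComplexity Finset

namespace Summit.MatrixMultiplication.OmegaCensus

/-! ## 1. The half-split family: one bit on `κ`, one bit by parity on `g` -/

section halfsplit

variable {G : Type*} [AddCommGroup G] [DecidableEq G]

/-- **The half-split `(1,2,2)` family `Aᵢ = {0}`, `Bᵢ = {4fᵢ•g, 4fᵢ•g + κ}`, `Cᵢ = {2fᵢ•g, (2fᵢ+1)•g}` is an STPP family** whenever `f` is injective with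
3-AP-free range, `fᵢ ≤ F`, and `c•g + a•κ = 0` with `|c| ≤ 4F + 1`, `a ∈ {−1,0,1}` forces `c = a = 0`.  The Def-5.1 word is
`(2(fⱼ + f_l − 2fᵢ) + e)•g + a•κ` with `e ∈ {−1,0,1}`. [cite: CohnKleinbergSzegedyUmans2005, Def. 5.1] -/
theorem isSTPP_apHalfSplitFam122 {k : ℕ} (f : Fin k → ℕ) (hf : Function.Injective f) (hap : ThreeAPFree (Set.range f))
    (F : ℕ) (hF : ∀ i, f i ≤ F) (g κ : G)
    (hind : ∀ c a : ℤ, -(4 * F + 1 : ℤ) ≤ c → c ≤ 4 * F + 1 → (a = -1 ∨ a = 0 ∨ a = 1) → c • g + a • κ = 0 → c = 0 ∧ a = 0) :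
    IsSTPP (fun _ : Fin k => ({0} : Finset G))
      (fun i => ({(4 * (f i : ℤ)) • g, (4 * (f i : ℤ)) • g + κ} : Finset G))
      (fun i => ({(2 * (f i : ℤ)) • g, (2 * (f i : ℤ) + 1) • g} : Finset G)) := by
  intro i j l s hs s' hs' t ht t' ht' u hu u' hu' heq
  simp only [Finset.mem_insert, Finset.mem_singleton] at hs hs' ht ht' hu hu'
  obtain ⟨e, he, rfl⟩ : ∃ e : ℤ, (e = 0 ∨ e = 1) ∧ t = (4 * (f i : ℤ)) • g + e • κ := by
    rcases ht with rfl | rfl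
    · exact ⟨0, Or.inl rfl, by simp⟩
    · exact ⟨1, Or.inr rfl, by simp⟩
  obtain ⟨e', he', rfl⟩ : ∃ e' : ℤ, (e' = 0 ∨ e' = 1) ∧ t' = (4 * (f j : ℤ)) • g + e' • κ := by
    rcases ht' with rfl | rfl
    · exact ⟨0, Or.inl rfl, by simp⟩
    · exact ⟨1, Or.inr rfl, by simp⟩
  obtain ⟨d, hd, rfl⟩ : ∃ d : ℤ, (d = 0 ∨ d = 1) ∧ u = (2 * (f j : ℤ) + d) • g := by
    rcases hu with rfl | rfl
    · exact ⟨0, Or.inl rfl, by simp⟩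
    · exact ⟨1, Or.inr rfl, rfl⟩
  obtain ⟨d', hd', rfl⟩ : ∃ d' : ℤ, (d' = 0 ∨ d' = 1) ∧ u' = (2 * (f l : ℤ) + d') • g := by
    rcases hu' with rfl | rfl
    · exact ⟨0, Or.inl rfl, by simp⟩
    · exact ⟨1, Or.inr rfl, rfl⟩
  subst hs hs'
  have hw : (2 * ((f j : ℤ) + (f l : ℤ) - 2 * (f i : ℤ)) + (d' - d)) • g + (e' - e) • κ = 0 := by
    rw [← heq]; module
  have hFi := hF i; have hFj := hF j; have hFl := hF l
  obtain ⟨hc, ha⟩ := hind _ _ (by omega) (by omega) (by omega) hw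
  have hdd : d = d' := by omega
  have hsum : f j + f l = f i + f i := by omega
  have hji : f j = f i := hap (Set.mem_range_self j) (Set.mem_range_self i) (Set.mem_range_self l) hsum
  have hli : f l = f i := by omega
  have hji' : j = i := hf hji
  have hli' : l = i := hf hli
  subst hji' hli' hdd
  refine ⟨rfl, rfl, rfl, ?_, rfl⟩
  have : e = e' := by omega
  subst this; rfl

/-- **`(1,2,2)^k ⊆ G`** from the half-split family. [cite: CohnKleinbergSzegedyUmans2005, Def. 5.1] -/
theorem exists_isSTPP_122pow_of_apHalfSplit {k : ℕ} (f : Fin k → ℕ) (hf : Function.Injective f) (hap : ThreeAPFree (Set.range f))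
    (F : ℕ) (hF : ∀ i, f i ≤ F) (g κ : G)
    (hind : ∀ c a : ℤ, -(4 * F + 1 : ℤ) ≤ c → c ≤ 4 * F + 1 → (a = -1 ∨ a = 0 ∨ a = 1) → c • g + a • κ = 0 → c = 0 ∧ a = 0) :
    ∃ A B C : Fin k → Finset G, IsSTPP A B C ∧ ∀ i, (A i).card = 1 ∧ (B i).card = 2 ∧ (C i).card = 2 := by
  have hκ : κ ≠ 0 := by
    intro h0
    have := (hind 0 1 (by omega) (by omega) (by omega) (by simp [h0])).2
    omega
  have hg : g ≠ 0 := by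
    intro h0
    have := (hind 1 0 (by omega) (by omega) (by omega) (by simp [h0])).1
    omega
  refine ⟨_, _, _, isSTPP_apHalfSplitFam122 f hf hap F hF g κ hind, fun i => ⟨card_singleton _, ?_, ?_⟩⟩
  · rw [card_insert_of_notMem (by simpa using hκ), card_singleton]
  · rw [card_insert_of_notMem, card_singleton]
    rw [Finset.mem_singleton, add_smul, one_smul]
    intro h
    exact hg (by simpa using h)

end halfsplit

/-! ## 2. Sign-independence in a quotient and the bounded independence of `g, κ₁, κ₂` -/

section generic

variable {G : Type*} [AddCommGroup G]

/-- `x ≠ 0` and `y ∉ {0, x, −x}` are sign-independent: `a•x + b•y = 0` with `a, b ∈ {−1,0,1}` forces `a = b = 0`. -/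
theorem signIndep_of_ne (x y : G) (hx : x ≠ 0) (hy0 : y ≠ 0) (hy1 : y ≠ x) (hy2 : y ≠ -x) :
    ∀ a b : ℤ, (a = -1 ∨ a = 0 ∨ a = 1) → (b = -1 ∨ b = 0 ∨ b = 1) → a • x + b • y = 0 → a = 0 ∧ b = 0 := by
  intro a b ha hb h
  rcases hb with rfl | rfl | rfl
  · rcases ha with rfl | rfl | rfl
    · rw [neg_one_zsmul, neg_one_zsmul, ← neg_add, neg_eq_zero] at h
      exact absurd (eq_neg_of_add_eq_zero_right h) hy2
    · rw [zero_zsmul, zero_add, neg_one_zsmul, neg_eq_zero] at h; exact absurd h hy0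
    · rw [one_zsmul, neg_one_zsmul, ← sub_eq_add_neg, sub_eq_zero] at h; exact absurd h.symm hy1
  · rcases ha with rfl | rfl | rfl
    · rw [neg_one_zsmul, zero_zsmul, add_zero, neg_eq_zero] at h; exact absurd h hx
    · exact ⟨rfl, rfl⟩
    · rw [one_zsmul, zero_zsmul, add_zero] at h; exact absurd h hx
  · rcases ha with rfl | rfl | rfl
    · rw [neg_one_zsmul, one_zsmul, neg_add_eq_zero] at h; exact absurd h.symm hy1
    · rw [zero_zsmul, zero_add, one_zsmul] at h; exact absurd h hy0
    · rw [one_zsmul, one_zsmul] at h; exact absurd (eq_neg_of_add_eq_zero_right h) hy2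

/-- An abelian group of order `≥ 4` has two sign-independent elements. -/
theorem exists_signIndep_of_four_le_card {Q : Type*} [AddCommGroup Q] [Finite Q] (hQ : 4 ≤ Nat.card Q) :
    ∃ x y : Q, ∀ a b : ℤ, (a = -1 ∨ a = 0 ∨ a = 1) → (b = -1 ∨ b = 0 ∨ b = 1) → a • x + b • y = 0 → a = 0 ∧ b = 0 := by
  classical
  haveI := Fintype.ofFinite Q
  have hcard : 4 ≤ Fintype.card Q := by rwa [← Nat.card_eq_fintype_card]
  obtain ⟨x, hx⟩ : ∃ x : Q, x ≠ 0 := by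
    by_contra h
    push Not at h
    have : Fintype.card Q ≤ 1 := Fintype.card_le_one_iff.2 (fun a b => by rw [h a, h b])
    omega
  have h3 : (({0, x, -x} : Finset Q)).card < Fintype.card Q :=
    lt_of_lt_of_le (lt_of_le_of_lt (Finset.card_le_three) (by norm_num)) hcard
  obtain ⟨y, -, hy⟩ := Finset.exists_mem_notMem_of_card_lt_card (s := ({0, x, -x} : Finset Q)) (t := Finset.univ)
    (by rwa [Finset.card_univ])
  simp only [Finset.mem_insert, Finset.mem_singleton, not_or] at hy
  exact ⟨x, y, signIndep_of_ne x y hx hy.1 hy.2.1 hy.2.2⟩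

/-- An abelian group of order `≥ 2` has a nonzero element. -/
theorem exists_ne_zero_of_two_le_card {Q : Type*} [AddCommGroup Q] [Finite Q] (hQ : 2 ≤ Nat.card Q) : ∃ x : Q, x ≠ 0 := by
  classical
  haveI := Fintype.ofFinite Q
  by_contra h
  push Not at h
  have : Fintype.card Q ≤ 1 := Fintype.card_le_one_iff.2 (fun a b => by rw [h a, h b])
  rw [← Nat.card_eq_fintype_card] at this
  omega

/-- **Bounded independence from the quotient by `⟨g⟩`.** If `ord g ≥ B + 1` and the images of `κ₁, κ₂` in `G ⧸ ⟨g⟩` are sign-independent, then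
`c•g + a•κ₁ + b•κ₂ = 0` with `|c| ≤ B`, `a, b ∈ {−1,0,1}` forces `c = a = b = 0`. -/
theorem apSplit_indep_of_quotient (B : ℕ) (g κ₁ κ₂ : G) (hg : B + 1 ≤ addOrderOf g)
    (hq : ∀ a b : ℤ, (a = -1 ∨ a = 0 ∨ a = 1) → (b = -1 ∨ b = 0 ∨ b = 1) →
      a • (QuotientAddGroup.mk κ₁ : G ⧸ AddSubgroup.zmultiples g) + b • (QuotientAddGroup.mk κ₂ : G ⧸ AddSubgroup.zmultiples g) = 0 →
      a = 0 ∧ b = 0) :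
    ∀ c a b : ℤ, -(B : ℤ) ≤ c → c ≤ B → (a = -1 ∨ a = 0 ∨ a = 1) → (b = -1 ∨ b = 0 ∨ b = 1) →
      c • g + a • κ₁ + b • κ₂ = 0 → c = 0 ∧ a = 0 ∧ b = 0 := by
  intro c a b hc1 hc2 ha hb hw
  have hq0 : (QuotientAddGroup.mk g : G ⧸ AddSubgroup.zmultiples g) = 0 :=
    (QuotientAddGroup.eq_zero_iff g).2 (AddSubgroup.mem_zmultiples g)
  have himg := congrArg (QuotientAddGroup.mk' (AddSubgroup.zmultiples g)) hw
  rw [map_add, map_add, map_zsmul, map_zsmul, map_zsmul, map_zero, QuotientAddGroup.mk'_apply, hq0, smul_zero,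
    zero_add] at himg
  obtain ⟨ra, rb⟩ := hq a b ha hb himg
  subst ra rb
  rw [zero_zsmul, zero_zsmul, add_zero, add_zero] at hw
  have hdvd : (addOrderOf g : ℤ) ∣ c := (addOrderOf_dvd_iff_zsmul_eq_zero).2 hw
  exact ⟨Int.eq_zero_of_dvd_of_natAbs_lt_natAbs hdvd (by simp only [Int.natAbs_natCast]; omega), rfl, rfl⟩

/-- **Bounded `T1`/half-split independence from the quotient by `⟨g⟩`.** If `ord g ≥ B + 1` and the image of `κ` in `G ⧸ ⟨g⟩` is nonzero, then
`c•g + a•κ = 0` with `|c| ≤ B`, `a ∈ {−1,0,1}` forces `c = a = 0`. -/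
theorem apSplit_indep₁_of_quotient (B : ℕ) (g κ : G) (hg : B + 1 ≤ addOrderOf g)
    (hq : (QuotientAddGroup.mk κ : G ⧸ AddSubgroup.zmultiples g) ≠ 0) :
    ∀ c a : ℤ, -(B : ℤ) ≤ c → c ≤ B → (a = -1 ∨ a = 0 ∨ a = 1) → c • g + a • κ = 0 → c = 0 ∧ a = 0 := by
  intro c a hc1 hc2 ha hw
  have hq0 : (QuotientAddGroup.mk g : G ⧸ AddSubgroup.zmultiples g) = 0 :=
    (QuotientAddGroup.eq_zero_iff g).2 (AddSubgroup.mem_zmultiples g)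
  have himg := congrArg (QuotientAddGroup.mk' (AddSubgroup.zmultiples g)) hw
  rw [map_add, map_zsmul, map_zsmul, map_zero, QuotientAddGroup.mk'_apply, hq0, smul_zero, zero_add] at himg
  have ra : a = 0 := by
    rcases ha with rfl | rfl | rfl
    · rw [neg_one_zsmul, neg_eq_zero] at himg; exact absurd himg hq
    · rfl
    · rw [one_zsmul] at himg; exact absurd himg hq
  subst ra
  rw [zero_zsmul, add_zero] at hw
  have hdvd : (addOrderOf g : ℤ) ∣ c := (addOrderOf_dvd_iff_zsmul_eq_zero).2 hw
  exact ⟨Int.eq_zero_of_dvd_of_natAbs_lt_natAbs hdvd (by simp only [Int.natAbs_natCast]; omega), rfl⟩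

/-- The quotient by `⟨g⟩` has order `|G| / ord g`: `|G| = |G ⧸ ⟨g⟩| · ord g`. -/
theorem card_eq_card_quotient_zmultiples_mul [Finite G] (g : G) :
    Nat.card G = Nat.card (G ⧸ AddSubgroup.zmultiples g) * addOrderOf g := by
  rw [AddSubgroup.card_eq_card_quotient_mul_card_addSubgroup (AddSubgroup.zmultiples g), Nat.card_zmultiples]

/-- **GENERIC SPLIT BRANCH: an element `g` of order `≥ 2F + 1` with `|G| ≥ 4·ord g` gives `(1,2,2)^k ⊆ G`.** [cite: CohnKleinbergSzegedyUmans2005, Def. 5.1] -/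
theorem exists_isSTPP_122pow_of_addOrderOf_split [Finite G] [DecidableEq G] {k : ℕ} (f : Fin k → ℕ) (hf : Function.Injective f)
    (hap : ThreeAPFree (Set.range f)) (F : ℕ) (hF : ∀ i, f i ≤ F) (g : G) (hg : 2 * F + 1 ≤ addOrderOf g)
    (hcard : 4 * addOrderOf g ≤ Nat.card G) :
    ∃ A B C : Fin k → Finset G, IsSTPP A B C ∧ ∀ i, (A i).card = 1 ∧ (B i).card = 2 ∧ (C i).card = 2 := by
  have hQ : 4 ≤ Nat.card (G ⧸ AddSubgroup.zmultiples g) := by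
    have h := card_eq_card_quotient_zmultiples_mul g
    have hpos : 0 < addOrderOf g := by omega
    by_contra hlt
    push Not at hlt
    have : Nat.card G ≤ 3 * addOrderOf g := by rw [h]; exact Nat.mul_le_mul_right _ (by omega)
    omega
  obtain ⟨x, y, hxy⟩ := exists_signIndep_of_four_le_card hQ
  obtain ⟨κ₁, rfl⟩ := QuotientAddGroup.mk_surjective x
  obtain ⟨κ₂, rfl⟩ := QuotientAddGroup.mk_surjective y
  exact exists_isSTPP_122pow_of_apSplit f hf hap F hF g κ₁ κ₂ (apSplit_indep_of_quotient (2 * F) g κ₁ κ₂ hg hxy)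

/-- **GENERIC HALF-SPLIT BRANCH: an element `g` of order `≥ 4F + 2` with `|G| ≥ 2·ord g` gives `(1,2,2)^k ⊆ G`.** [cite: CohnKleinbergSzegedyUmans2005, Def. 5.1] -/
theorem exists_isSTPP_122pow_of_addOrderOf_halfSplit [Finite G] [DecidableEq G] {k : ℕ} (f : Fin k → ℕ) (hf : Function.Injective f)
    (hap : ThreeAPFree (Set.range f)) (F : ℕ) (hF : ∀ i, f i ≤ F) (g : G) (hg : 4 * F + 2 ≤ addOrderOf g)
    (hcard : 2 * addOrderOf g ≤ Nat.card G) :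
    ∃ A B C : Fin k → Finset G, IsSTPP A B C ∧ ∀ i, (A i).card = 1 ∧ (B i).card = 2 ∧ (C i).card = 2 := by
  have hQ : 2 ≤ Nat.card (G ⧸ AddSubgroup.zmultiples g) := by
    have h := card_eq_card_quotient_zmultiples_mul g
    by_contra hlt
    push Not at hlt
    have : Nat.card G ≤ 1 * addOrderOf g := by rw [h]; exact Nat.mul_le_mul_right _ (by omega)
    omega
  obtain ⟨x, hx⟩ := exists_ne_zero_of_two_le_card hQ
  obtain ⟨κ, rfl⟩ := QuotientAddGroup.mk_surjective x
  exact exists_isSTPP_122pow_of_apHalfSplit f hf hap F hF g κ (apSplit_indep₁_of_quotient (4 * F + 1) g κ (by omega) hx)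

end generic

/-! ## 3. The minimal seed bridge with a product bound (for the band `|G| = 3·exponent`) -/

/-- **GENERIC SEED BRIDGE, MINIMAL FORM WITH A PRODUCT BOUND.** As `exists_seed_emb_of_core_min`, for groups with `|G| ≤ 3 · exponent`: the core is only
required for (minimal) capped multisets `M` of exponent `E` with `M.prod ≤ 3E`. [folklore] -/
theorem exists_seed_emb_of_core_min_le (P : ℕ → Prop) {N Emax : ℕ} (CL : ℕ → List (ℕ × ℕ)) {L : List (List ℕ)}
    (hcap : ∀ E ∈ List.range' 1 Emax, ∀ p k : ℕ, p.Prime → P p → 0 < k → p ^ k ∣ E →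
      N ≤ (p ^ k) ^ Multiset.count (p ^ k) (capMS (CL E)))
    (hcore : ∀ E ∈ List.range' 1 Emax, ∀ M ∈ subMS (CL E), N ≤ M.prod → M.prod ≤ 3 * E → (∀ x ∈ M, M.prod < N * x) →
      ∃ s ∈ L, dom s M = true)
    {G : Type*} [AddCommGroup G] [Finite G] (hP : ∀ p : ℕ, p.Prime → p ∣ Nat.card G → P p)
    (hexp : AddMonoid.exponent G ≤ Emax) (hG : N ≤ Nat.card G) (h3 : Nat.card G ≤ 3 * AddMonoid.exponent G) :
    ∃ s ∈ L, ∃ φ : SeedType s →+ G, Function.Injective φ := by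
  classical
  obtain ⟨ι, _, p, hp, e, ⟨g⟩⟩ := AddCommGroup.equiv_directSum_zmod_of_finite G
  let f : G ≃+ (Π i, ZMod (p i ^ e i)) :=
    g.trans (DirectSum.linearEquivFunOnFintype ℕ ι (fun i => ZMod (p i ^ e i))).toAddEquiv
  have hE1 : 1 ≤ AddMonoid.exponent G := Nat.pos_of_ne_zero AddMonoid.exponent_ne_zero_of_finite
  have hdvd : ∀ i, p i ^ e i ∣ AddMonoid.exponent G := fun i => by
    have hinj : Function.Injective (AddMonoidHom.single (fun j => ZMod (p j ^ e j)) i) :=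
      Pi.single_injective (M := fun j => ZMod (p j ^ e j)) i
    have h1 : addOrderOf (f.symm (AddMonoidHom.single (fun j => ZMod (p j ^ e j)) i 1)) = p i ^ e i := by
      rw [AddEquiv.addOrderOf_eq, addOrderOf_injective _ hinj, ZMod.addOrderOf_one]
    rw [← h1]
    exact AddMonoid.addOrder_dvd_exponent _
  have hq0 : ∀ i, p i ^ e i ≠ 0 := fun i => pow_ne_zero _ (hp i).ne_zero
  set M : Multiset ℕ := (Finset.univ.filter fun i => 0 < e i).val.map fun i => p i ^ e i with hM
  have hprodeq : M.prod = ∏ i, p i ^ e i := by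
    rw [hM, ← Finset.prod_eq_multiset_prod]
    exact Finset.prod_filter_of_ne fun i _ hi => Nat.pos_of_ne_zero fun h0 => hi (by rw [h0, pow_zero])
  have hcardeq : Nat.card G = ∏ i, p i ^ e i := by
    rw [Nat.card_congr f.toEquiv, Nat.card_pi]
    simp [Nat.card_zmod]
  have hEI : AddMonoid.exponent G ∈ List.range' 1 Emax := List.mem_range'_1.2 ⟨hE1, by omega⟩
  set C := capMS (CL (AddMonoid.exponent G)) with hC
  have hprodN : N ≤ M.prod := by rw [hprodeq, ← hcardeq]; exact hG
  have hmemM : ∀ a ∈ M, ∃ i, 0 < e i ∧ a = p i ^ e i := by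
    intro a ha
    obtain ⟨i, hi, rfl⟩ := Multiset.mem_map.1 ha
    exact ⟨i, (Finset.mem_filter.1 hi).2, rfl⟩
  have hpos : ∀ a ∈ M, 1 ≤ a := by
    intro a ha
    obtain ⟨i, hi, rfl⟩ := hmemM a ha
    exact Nat.one_le_iff_ne_zero.2 (hq0 i)
  have hcapM : ∀ a ∈ M, N ≤ a ^ Multiset.count a C := by
    intro a ha
    obtain ⟨i, hi, rfl⟩ := hmemM a ha
    have hPi : P (p i) := hP (p i) (hp i) (by
      rw [hcardeq]
      exact dvd_trans (dvd_pow_self (p i) hi.ne') (Finset.dvd_prod_of_mem _ (Finset.mem_univ i)))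
    exact hcap _ hEI (p i) (e i) (hp i) hPi hi (hdvd i)
  have hcapd := prod_inter_ge_of (C := C) hprodN hpos hcapM
  obtain ⟨M', hM'le, hM'N, hM'min⟩ := exists_le_minimal_prod_ge N (M ∩ C) hcapd
  have hsub : M' ∈ subMS (CL (AddMonoid.exponent G)) := mem_subMS_of_le _ _ (hM'le.trans Multiset.inter_le_right)
  have hM'prod : M'.prod ≤ 3 * AddMonoid.exponent G := by
    have hdv : M'.prod ∣ M.prod := Multiset.prod_dvd_prod_of_le (hM'le.trans Multiset.inter_le_left)
    have hMpos : 0 < M.prod := by rw [hprodeq, ← hcardeq]; exact Nat.card_pos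
    exact le_trans (Nat.le_of_dvd hMpos hdv) (by rw [hprodeq, ← hcardeq]; exact h3)
  obtain ⟨s, hs, hD⟩ := hcore _ hEI M' hsub hM'N hM'prod hM'min
  obtain ⟨φ, hφ, -⟩ := exists_emb_of_dom (fun i => p i ^ e i) hq0 s _
    (dom_mono s (hM'le.trans Multiset.inter_le_left) hD)
  exact ⟨s, hs, f.symm.toAddMonoidHom.comp φ, f.symm.injective.comp hφ⟩

/-! ## 4. The split law bridge -/

/-- **THE SPLIT LAW BRIDGE for `(1,2,2)^k`.** Data: an injective `f : Fin k → ℕ` with 3-AP-free range and `fᵢ ≤ F`; the cyclic ray for `m ≥ 8F + 4`;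
a threshold `N ≥ 8F + 4`; cap lists `CL` whose caps reach `N` for every prime power dividing an exponent `≤ 4F + 1`; a seed list `L` of hosts; a kernel
core over the exponents `E ≤ 2F` (minimal capped multisets of product `≥ N`) and a BAND core over `2F < E ≤ 4F + 1` restricted to minimal capped
multisets with `N ≤ M.prod ≤ 3E`.  Then **every finite abelian group of order `≥ N` hosts `(1,2,2)^k`**: exponent `≥ 8F + 4` ⇒ ray; `≥ 4F + 2` ⇒
half-split; `≥ 2F + 1` and `|G| ≥ 4e` ⇒ split; `= 3e` ⇒ band core; `≤ 2F` ⇒ core. [cite: CohnKleinbergSzegedyUmans2005, Def. 5.1] -/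
theorem exists_isSTPP_122pow_of_card_ge_split {k : ℕ} (f : Fin k → ℕ) (hf : Function.Injective f) (hap : ThreeAPFree (Set.range f))
    (F : ℕ) (hF : ∀ i, f i ≤ F)
    (hray : ∀ m : ℕ, 8 * F + 4 ≤ m → ∃ A B C : Fin k → Finset (ZMod m), IsSTPP A B C ∧
      ∀ i, (A i).card = 1 ∧ (B i).card = 2 ∧ (C i).card = 2)
    {N : ℕ} (hN : 8 * F + 4 ≤ N) (CL : ℕ → List (ℕ × ℕ)) {L : List (List ℕ)}
    (hcap : ∀ E ∈ List.range' 1 (4 * F + 1), ∀ p j : ℕ, p.Prime → True → 0 < j → p ^ j ∣ E →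
      N ≤ (p ^ j) ^ Multiset.count (p ^ j) (capMS (CL E)))
    (hlow : ∀ E ∈ List.range' 1 (2 * F), ∀ M ∈ subMS (CL E), N ≤ M.prod → (∀ x ∈ M, M.prod < N * x) → ∃ s ∈ L, dom s M = true)
    (hband : ∀ E ∈ List.range' (2 * F + 1) (2 * F + 1), ∀ M ∈ subMS (CL E), N ≤ M.prod → M.prod ≤ 3 * E →
      (∀ x ∈ M, M.prod < N * x) → ∃ s ∈ L, dom s M = true)
    (hL : ∀ s ∈ L, ∃ A B C : Fin k → Finset (SeedType s), IsSTPP A B C ∧ ∀ i, (A i).card = 1 ∧ (B i).card = 2 ∧ (C i).card = 2)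
    {G : Type*} [AddCommGroup G] [Finite G] (hG : N ≤ Nat.card G) :
    ∃ A B C : Fin k → Finset G, IsSTPP A B C ∧ ∀ i, (A i).card = 1 ∧ (B i).card = 2 ∧ (C i).card = 2 := by
  classical
  set e := AddMonoid.exponent G with he
  obtain ⟨g, hg⟩ := AddMonoid.exists_addOrderOf_eq_exponent (AddMonoid.ExponentExists.of_finite (G := G))
  have hediv : e ∣ Nat.card G := AddGroup.exponent_dvd_nat_card
  have hE1 : 1 ≤ e := Nat.pos_of_ne_zero AddMonoid.exponent_ne_zero_of_finite
  obtain ⟨q, hq⟩ := hediv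
  by_cases h8 : 8 * F + 4 ≤ e
  · exact exists_isSTPP_cards_of_exponent_ge (R := 8 * F + 4) (fun _ => True) (fun m hm _ => hray m hm) h8 trivial
  by_cases h4 : 4 * F + 2 ≤ e
  · -- |G| = q e with q ≥ 2
    have hq2 : 2 ≤ q := by
      by_contra hlt
      push Not at hlt
      interval_cases q <;> [simp at hq; rw [mul_one] at hq] <;> omega
    exact exists_isSTPP_122pow_of_addOrderOf_halfSplit f hf hap F hF g (by rw [hg]; exact h4)
      (by rw [hg, hq]; nlinarith)
  by_cases h2 : 2 * F + 1 ≤ e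
  · by_cases hq4 : 4 ≤ q
    · exact exists_isSTPP_122pow_of_addOrderOf_split f hf hap F hF g (by rw [hg]; exact h2) (by rw [hg, hq]; nlinarith)
    · -- q = 3 (q ≤ 2 contradicts |G| ≥ N ≥ 8F+4 > 2e)
      have hq3 : Nat.card G ≤ 3 * e := by rw [hq]; nlinarith
      obtain ⟨s, hs, φ, hφ⟩ := exists_seed_emb_of_core_min_le (fun _ => True) (Emax := 4 * F + 1) CL hcap
        (by
          intro E hE M hM hNM h3M hmin
          obtain ⟨hE1', hE2'⟩ := List.mem_range'_1.1 hE
          by_cases hEl : E ≤ 2 * F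
          · exact hlow E (List.mem_range'_1.2 ⟨hE1', by omega⟩) M hM hNM hmin
          · exact hband E (List.mem_range'_1.2 ⟨by omega, by omega⟩) M hM hNM h3M hmin)
        (fun _ _ _ => trivial) (by omega) hG hq3
      exact exists_isSTPP_cards_of_injective φ hφ (hL s hs)
  · -- e ≤ 2F
    push Not at h2
    exact exists_isSTPP_cards_of_core_min (fun _ => True) (Emax := 2 * F) CL
      (fun E hE p j hp hP hj hd => hcap E (by
        obtain ⟨h1', h2'⟩ := List.mem_range'_1.1 hE
        exact List.mem_range'_1.2 ⟨h1', by omega⟩) p j hp hP hj hd)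
      hlow hL (fun _ _ _ => trivial) (by omega) hG

end Summit.MatrixMultiplication.OmegaCensus
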